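import Summits.NavierStokesRegularity.NavierStokesRegularity.Theorems.ExtremiserTransienceNearExtremalTransiencePerFlowStubUbiquityToLimit
import Literature.Analysis.FluidPDE.BoundedMildSmoothRemainder
import Literature.Analysis.FluidPDE.TypeIAncientMildRescale
import HarnessLib

/-!
# Route `ExtremiserTransience`, crux `NearExtremalTransiencePerFlow` (stmt-NavierStokesRegularity-26567),
# LINE g10-α «dissipation ledger», stub L2 — part 1: THE UNIFORM SPACE–TIME LIPSCHITZ PACKAGE OF THE TYPE-I ANCIENT MILD CLASS

`--supports stmt-NavierStokesRegularity-26567` (helper for the registered stub L2 `stub_violatorDissipation` of the skeleton of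
record `Cruxes/NearExtremalTransiencePerFlow/Lines/dissipation_ledger.lean`, and of LINE g10-β `tight_or_chain`, which registers the
same stub character for character).  Prover seat `ns-net-p1` (g11).

WHAT IS PROVED (all constants UNIFORM in the field — they depend on the Type-I constant `K` only, as the `∀ K A ε ∃ c D a ∀ W`
shape of L2 demands):

* `exists_unitWindow_package` — KNSS 2009, Prop. 4.1 / (4.10)–(4.11) with its class-uniform constants
  (`KNSS2009_mild_regularity_holds`, applied to the time-clamped translate `σ ↦ W(σ − 1)` on the forward window `[0, 7/8]`, where
  `‖W‖ ≤ K√8`, via `isKNSSDriftMild_clamp_of_oseenForward`): every `W` with `IsTypeIAncientMild K W` is `K₁`-Lipschitz in space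
  and `L₀`-Lipschitz in time on the slab `[−1/2, −1/4] × ℝ³`;
* `exists_scaled_package` — the scale-invariant form by the Navier–Stokes rescaling `IsTypeIAncientMild.nsRescale` with
  `λ = 2√(−τ)`: on `[2τ, τ] × ℝ³`, `‖W t z − W t x‖ ≤ K₁‖z − x‖/(−τ)` and `‖W t′ x − W t x‖ ≤ L₀|t′ − t|/((−τ)√(−τ))`;
* `continuousOn_fderiv_slice` — `(t, x) ↦ D(W t)(x)` is jointly continuous on `(−∞,0) × ℝ³` (chain rule through `inr`), the
  measurability input for Tonelli on the dissipation measure.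

HONEST FRAMING: parabolic-regularity bookkeeping for the KNSS-gauge Type-I class; nothing about Navier–Stokes regularity or blow-up
is proved; no summit is proved by a line. [cite: KochNadirashviliSereginSverak2009, Prop. 4.1 with (4.6), §4 (4.10)–(4.11) (arXiv:0709.3599v1 p. 8)]
-/

noncomputable section

open scoped Topology ENNReal ContDiff
open MeasureTheory Filter Set Metric Function
open Literature.Analysis Literature.Analysis.FluidPDE Literature.Analysis.UnboundedOperators

namespace Summit.NavierStokesRegularity.NavierStokesRegularity.Theorems.NearExtremalTransiencePerFlow.DissipationLedger

-- the problem directory repeats the summit name (`NavierStokesRegularity/NavierStokesRegularity`)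
set_option linter.dupNamespace false

/-- `‖D⁰f x - D⁰g x‖ = ‖f x - g x‖` (the `0`-th iterated derivative is `f` read through a linear isometry). [folklore] -/
theorem norm_iteratedFDeriv_zero_sub {f g : EuclideanSpace ℝ (Fin 3) → EuclideanSpace ℝ (Fin 3)}
    (x : EuclideanSpace ℝ (Fin 3)) :
    ‖iteratedFDeriv ℝ 0 f x - iteratedFDeriv ℝ 0 g x‖ = ‖f x - g x‖ := by
  rw [iteratedFDeriv_zero_eq_comp, iteratedFDeriv_zero_eq_comp, Function.comp_apply, Function.comp_apply,
    ← map_sub, LinearIsometryEquiv.norm_map]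

/-- **Unit-window package, uniform in the field** (KNSS 2009 Prop. 4.1 / (4.10)–(4.11) on the window `[-1, -1/8]`):
for every `K` there are `K₁, L₀ ≥ 0` such that every `W` of the class `IsTypeIAncientMild K W` is `K₁`-Lipschitz in space
and `L₀`-Lipschitz in time on the slab `[-1/2, -1/4] × ℝ³`. [cite: KochNadirashviliSereginSverak2009, Prop. 4.1 with (4.6), §4 (4.10)–(4.11) (arXiv:0709.3599v1 p. 8)] -/
theorem exists_unitWindow_package (K : ℝ) :
    ∃ K₁ L₀ : ℝ, 0 ≤ K₁ ∧ 0 ≤ L₀ ∧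
      ∀ (W : ℝ → EuclideanSpace ℝ (Fin 3) → EuclideanSpace ℝ (Fin 3)), IsTypeIAncientMild K W →
        ∀ t ∈ Icc (-1 / 2 : ℝ) (-1 / 4),
          (∀ x z : EuclideanSpace ℝ (Fin 3), ‖W t z - W t x‖ ≤ K₁ * ‖z - x‖) ∧
          ∀ t' ∈ Icc (-1 / 2 : ℝ) (-1 / 4), ∀ x : EuclideanSpace ℝ (Fin 3), ‖W t' x - W t x‖ ≤ L₀ * |t' - t| := by
  -- the uniform constants of KNSS §4 on the window of length `7/8` with bound `B = K √8`
  set B : ℝ := K * Real.sqrt 8 with hB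
  obtain ⟨C, L, hCL⟩ := KNSS2009_mild_regularity_holds B (7 / 8) (by norm_num)
  refine ⟨max (C 1 (1 / 4)) 0, max (L 0 (1 / 4)) 0, le_max_right _ _, le_max_right _ _, fun W hW => ?_⟩
  have hK0 : 0 ≤ K := hW.nonneg
  -- the translate `u σ = W (σ - 1)` on `[0, 7/8]`
  set u : ℝ → EuclideanSpace ℝ (Fin 3) → EuclideanSpace ℝ (Fin 3) := fun σ => W (σ - 1) with hu
  have hneg : ∀ σ ∈ Icc (0 : ℝ) (7 / 8), σ - 1 < 0 := fun σ hσ => by linarith [hσ.2]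
  have hcont : ContinuousOn (uncurry u) (Icc 0 (7 / 8) ×ˢ univ) := by
    have e : uncurry u = uncurry W ∘ fun p : ℝ × EuclideanSpace ℝ (Fin 3) => (p.1 - 1, p.2) := by
      funext p; rfl
    rw [e]
    refine hW.continuousOn_uncurry.comp (by fun_prop) ?_
    intro p hp
    exact ⟨hneg p.1 hp.1, mem_univ _⟩
  have hbd : ∀ σ ∈ Icc (0 : ℝ) (7 / 8), ∀ x, ‖u σ x‖ ≤ B := by
    intro σ hσ x
    refine (hW.norm_le (hneg σ hσ) x).trans ?_
    have h8 : Real.sqrt (1 / 8) ≤ Real.sqrt (-(σ - 1)) := Real.sqrt_le_sqrt (by linarith [hσ.2])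
    have h8' : 0 < Real.sqrt (1 / 8 : ℝ) := Real.sqrt_pos.2 (by norm_num)
    have hs8 : Real.sqrt 8 * Real.sqrt (1 / 8 : ℝ) = 1 := by
      rw [← Real.sqrt_mul (by norm_num)]; norm_num
    calc K / Real.sqrt (-(σ - 1)) ≤ K / Real.sqrt (1 / 8) := div_le_div_of_nonneg_left hK0 h8' h8
      _ = B := by
        rw [hB, div_eq_iff h8'.ne', mul_assoc, hs8, mul_one]
  have hdiv : ∀ σ ∈ Icc (0 : ℝ) (7 / 8), IsWeaklyDivFree (u σ) := fun σ hσ => hW.isWeaklyDivFree (hneg σ hσ)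
  have hmild : ∀ s σ : ℝ, 0 ≤ s → s < σ → σ ≤ 7 / 8 → ∀ x,
      u σ x = heatExtension (u s) (σ - s) x - oseenDuhamel 1 s u u σ x := by
    intro s σ hs hsσ hσ x
    have h := hW.mild_eq_heatExtension (s := s - 1) (t := σ - 1) (by linarith) (by linarith) x
    rw [show σ - 1 - (s - 1) = σ - s by ring] at h
    rw [hu, oseenDuhamel_comp_sub_right 1 s σ 1 W W x]
    exact h
  have hV := isKNSSDriftMild_clamp_of_oseenForward (by norm_num : (0 : ℝ) < 7 / 8) hcont hbd hdiv hmild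
  obtain ⟨-, -, hCk, hLk, -⟩ := hCL hV
  -- the clamped field at an interior time is the slice of `W`
  have hclamp : ∀ σ ∈ Ioo (0 : ℝ) (7 / 8),
      (fun x => u (max 0 (min σ (7 / 8))) x) = W (σ - 1) := by
    intro σ hσ
    funext x
    rw [min_eq_left hσ.2.le, max_eq_right hσ.1.le]
  intro t ht
  have hσt : t + 1 ∈ Ioo (1 / 4 : ℝ) (7 / 8) := ⟨by linarith [ht.1], by linarith [ht.2]⟩
  have hσt' : t + 1 ∈ Ioo (0 : ℝ) (7 / 8) := ⟨by linarith [ht.1], hσt.2⟩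
  have ht0 : t < 0 := by linarith [ht.2]
  refine ⟨fun x z => ?_, fun t' ht' x => ?_⟩
  · -- spatial Lipschitz bound from `‖D¹‖ ≤ C 1 (1/4)`
    have hD1 : ∀ y, ‖iteratedFDeriv ℝ 1 (W t) y‖ ≤ max (C 1 (1 / 4)) 0 := by
      intro y
      have h := hCk (1 / 4) (by norm_num) 1 (t + 1) hσt y
      rw [hclamp (t + 1) hσt', show t + 1 - 1 = t by ring] at h
      exact h.trans (le_max_left _ _)
    exact norm_sub_le_of_iteratedFDeriv_one_le (hW.contDiff_slice ht0) hD1 z x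
  · -- temporal Lipschitz bound from the `k = 0` clause
    have hσt'' : t' + 1 ∈ Ioo (1 / 4 : ℝ) (7 / 8) := ⟨by linarith [ht'.1], by linarith [ht'.2]⟩
    have hσt''' : t' + 1 ∈ Ioo (0 : ℝ) (7 / 8) := ⟨by linarith [ht'.1], hσt''.2⟩
    have h := hLk (1 / 4) (by norm_num) 0 (t + 1) hσt (t' + 1) hσt'' x
    rw [hclamp (t + 1) hσt', hclamp (t' + 1) hσt''', show t + 1 - 1 = t by ring,
      show t' + 1 - 1 = t' by ring, norm_iteratedFDeriv_zero_sub, show t' + 1 - (t + 1) = t' - t by ring] at h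
    exact h.trans (mul_le_mul_of_nonneg_right (le_max_left _ _) (abs_nonneg _))

/-- **Scale-invariant package** (NS rescaling `IsTypeIAncientMild.nsRescale` with `λ = 2√(-τ)` of the unit-window package):
for every `K` there are `K₁, L₀ ≥ 0` such that every `W` of the class `IsTypeIAncientMild K W` satisfies, for every `τ < 0`
and all `t, t' ∈ [2τ, τ]`, `‖W t z - W t x‖ ≤ K₁‖z - x‖/(-τ)` and `‖W t' x - W t x‖ ≤ L₀|t' - t|/((-τ)√(-τ))`. [cite: KochNadirashviliSereginSverak2009, §1 (1.2) and Prop. 4.1 (arXiv:0709.3599v1)] -/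
theorem exists_scaled_package (K : ℝ) :
    ∃ K₁ L₀ : ℝ, 0 ≤ K₁ ∧ 0 ≤ L₀ ∧
      ∀ (W : ℝ → EuclideanSpace ℝ (Fin 3) → EuclideanSpace ℝ (Fin 3)), IsTypeIAncientMild K W →
        ∀ τ : ℝ, τ < 0 → ∀ t ∈ Icc (2 * τ) τ,
          (∀ x z : EuclideanSpace ℝ (Fin 3), ‖W t z - W t x‖ ≤ K₁ / (-τ) * ‖z - x‖) ∧
          ∀ t' ∈ Icc (2 * τ) τ, ∀ x : EuclideanSpace ℝ (Fin 3),
            ‖W t' x - W t x‖ ≤ L₀ / (-τ * Real.sqrt (-τ)) * |t' - t| := by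
  obtain ⟨K₁, L₀, hK₁, hL₀, hP⟩ := exists_unitWindow_package K
  refine ⟨K₁ / 4, L₀ / 8, by positivity, by positivity, fun W hW τ hτ t ht => ?_⟩
  have hnτ : 0 < -τ := neg_pos.2 hτ
  set L : ℝ := Real.sqrt (-τ) with hLdef
  have hL : 0 < L := Real.sqrt_pos.2 hnτ
  have hL2 : L ^ 2 = -τ := Real.sq_sqrt hnτ.le
  set l : ℝ := 2 * L with hldef
  have hl : 0 < l := by positivity
  have hl2 : l ^ 2 = 4 * (-τ) := by rw [hldef, mul_pow, hL2]; norm_num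
  have hl3 : l ^ 3 = 8 * (-τ * Real.sqrt (-τ)) := by
    rw [show l ^ 3 = l ^ 2 * l by ring, hl2, hldef]; ring
  have hWl := hW.nsRescale hl
  -- `W (l² s) x = l⁻¹ • (nsRescale l W) s (l⁻¹ • x)`
  have hkey : ∀ (s : ℝ) (x : EuclideanSpace ℝ (Fin 3)), W (l ^ 2 * s) x = l⁻¹ • nsRescale l W s (l⁻¹ • x) := by
    intro s x
    rw [nsRescale_apply, smul_smul, smul_smul, mul_inv_cancel₀ hl.ne', inv_mul_cancel₀ hl.ne', one_smul, one_smul]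
  -- rescaled times
  have hwin : ∀ t₀ ∈ Icc (2 * τ) τ, t₀ / l ^ 2 ∈ Icc (-1 / 2 : ℝ) (-1 / 4) ∧ l ^ 2 * (t₀ / l ^ 2) = t₀ := by
    intro t₀ ht₀
    have hl2pos : 0 < l ^ 2 := by positivity
    refine ⟨⟨?_, ?_⟩, mul_div_cancel₀ t₀ hl2pos.ne'⟩
    · rw [le_div_iff₀ hl2pos, hl2]; linarith [ht₀.1]
    · rw [div_le_iff₀ hl2pos, hl2]; linarith [ht₀.2]
  obtain ⟨hs, hts⟩ := hwin t ht
  obtain ⟨hsp, htm⟩ := hP (nsRescale l W) hWl (t / l ^ 2) hs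
  have hnorm : ∀ v : EuclideanSpace ℝ (Fin 3), ‖l⁻¹ • v‖ = l⁻¹ * ‖v‖ := fun v => by
    rw [norm_smul, Real.norm_eq_abs, abs_of_pos (inv_pos.2 hl)]
  refine ⟨fun x z => ?_, fun t' ht' x => ?_⟩
  · have h := hsp (l⁻¹ • x) (l⁻¹ • z)
    rw [← smul_sub, hnorm] at h
    rw [← hts, hkey, hkey, ← smul_sub, hnorm]
    calc l⁻¹ * ‖nsRescale l W (t / l ^ 2) (l⁻¹ • z) - nsRescale l W (t / l ^ 2) (l⁻¹ • x)‖
        ≤ l⁻¹ * (K₁ * (l⁻¹ * ‖z - x‖)) := mul_le_mul_of_nonneg_left h (inv_pos.2 hl).le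
      _ = K₁ / 4 / -τ * ‖z - x‖ := by
        have hτl : -τ = l ^ 2 / 4 := by linarith [hl2]
        rw [hτl]; field_simp
  · obtain ⟨hs', hts'⟩ := hwin t' ht'
    have h := htm (t' / l ^ 2) hs' (l⁻¹ • x)
    rw [← hts, ← hts', hkey, hkey, ← smul_sub, hnorm, mul_div_cancel₀ _ (by positivity : (l ^ 2 : ℝ) ≠ 0),
      mul_div_cancel₀ _ (by positivity : (l ^ 2 : ℝ) ≠ 0)]
    have habs : |t' / l ^ 2 - t / l ^ 2| = |t' - t| / l ^ 2 := by
      rw [← sub_div, abs_div, abs_of_pos (by positivity : (0 : ℝ) < l ^ 2)]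
    rw [habs] at h
    calc l⁻¹ * ‖nsRescale l W (t' / l ^ 2) (l⁻¹ • x) - nsRescale l W (t / l ^ 2) (l⁻¹ • x)‖
        ≤ l⁻¹ * (L₀ * (|t' - t| / l ^ 2)) := mul_le_mul_of_nonneg_left h (inv_pos.2 hl).le
      _ = L₀ / l ^ 3 * |t' - t| := by field_simp
      _ = L₀ / 8 / (-τ * Real.sqrt (-τ)) * |t' - t| := by rw [hl3, div_div]

/-- **Joint continuity of the slice derivative.**  For a field of the class, `(t, x) ↦ fderiv ℝ (W t) x` is continuous on the
open slab `(-∞, 0) × ℝ³`: it is the composition of the (jointly continuous) derivative of `uncurry W` with the inclusion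
`inr : ℝ³ → ℝ × ℝ³`. [folklore] -/
theorem continuousOn_fderiv_slice {K : ℝ} {W : ℝ → EuclideanSpace ℝ (Fin 3) → EuclideanSpace ℝ (Fin 3)}
    (hW : IsTypeIAncientMild K W) :
    ContinuousOn (fun p : ℝ × EuclideanSpace ℝ (Fin 3) => fderiv ℝ (W p.1) p.2) (Iio 0 ×ˢ univ) := by
  have hS : IsOpen (Iio (0 : ℝ) ×ˢ (univ : Set (EuclideanSpace ℝ (Fin 3)))) := isOpen_Iio.prod isOpen_univ
  have hU := hW.contDiffOn
  have hcontD : ContinuousOn (fun p => fderiv ℝ (uncurry W) p) (Iio 0 ×ˢ univ) :=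
    hU.continuousOn_fderiv_of_isOpen hS (by simp)
  have hcomp : ContinuousOn (fun p : ℝ × EuclideanSpace ℝ (Fin 3) =>
      (fderiv ℝ (uncurry W) p).comp (ContinuousLinearMap.inr ℝ ℝ (EuclideanSpace ℝ (Fin 3)))) (Iio 0 ×ˢ univ) :=
    hcontD.clm_comp continuousOn_const
  refine hcomp.congr fun p hp => ?_
  -- `W p.1 = uncurry W ∘ (p.1, ·)`, chain rule at `p.2`
  have hdiff : DifferentiableAt ℝ (uncurry W) (p.1, p.2) :=
    (hU.differentiableOn (by simp)).differentiableAt (hS.mem_nhds hp)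
  have h2 : HasFDerivAt (fun y : EuclideanSpace ℝ (Fin 3) => (p.1, y))
      (ContinuousLinearMap.inr ℝ ℝ (EuclideanSpace ℝ (Fin 3))) p.2 := hasFDerivAt_prodMk_right p.1 p.2
  have h := hdiff.hasFDerivAt.comp p.2 h2
  have e : (uncurry W ∘ fun y : EuclideanSpace ℝ (Fin 3) => (p.1, y)) = W p.1 := by funext y; rfl
  rw [e] at h
  exact h.fderiv

end Summit.NavierStokesRegularity.NavierStokesRegularity.Theorems.NearExtremalTransiencePerFlow.DissipationLedger

end
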